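import Summits.BirchSwinnertonDyer.Rank1Residual.X12.O11.StrictSelmerIndexModTorsion
import HarnessLib

/-!
# The strict Selmer index in rank one with local `p`-torsion allowed — over `ℚ`:
# `#Sel_str(E/ℚ)[p^∞] = p^ñ · #Ш(E/ℚ)[p^∞]` for EVERY `E/ℚ` of rank one and EVERY prime `p`,
# `ñ` = level of the generator in `E(ℚ_p)` modulo torsion (cell `bsd-print-cfram`, D-0131 (2), typer
# `ty2` gen 3; PLAN v5 ask (δ)(ii); sequel of `StrictSelmerIndexModTorsion.lean`, split for the
# ≤ 400-line rule; regime T of route `PrintCFram`, item stmt-BirchSwinnertonDyer-20699)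

HONEST FRAMING (cell `bsd-print-cfram`, HOME `run/shared/lean/pub/bsd-print-cfram/`): THEOREMS ONLY
(no definition, no named fact, no axiom, no `sorry`); nothing about BSD; beyond-print theorem: NO.

* `card_strictSelmerPInfty_eq_pow_mul_card_sha_modTorsion` — the general count of the prequel fed with
  `λ : E(ℚ_p) → ℤ_p` (AEC VII.6.3, `exists_addMonoidHom_padicInt_ker_torsion_pow_mem_range`) and the
  transport of the Selmer local condition to `ℚ_[p]` (`selmerGroupPInfty_le_selmerLocalKerPrimary_padic`);
* `padicValNat_card_strictSelmerPInfty_eq_modTorsion` — `ord_p #Sel_str = ñ + ord_p #Ш[p^∞]`;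
* `exists_generator_with_modTorsion_level` — Mordell–Weil generator with its exact mod-torsion level.
b2b's `strictSelmerIndexAt_holds` / `exists_generator_with_level` are the case `E(ℚ_p)[p] = 0`.

References: [GreenbergLNM1716] §2 (pp. 62–63); [KuriharaPollack2007] §1.5 (p. 361); [SilvermanAEC2009]
Prop. VII.6.3, Thm. VIII.6.7; tree: `Additive/StrictSelmerIndex.lean` (cell b2b-bsdres).
-/

universe u

noncomputable section

open scoped Classical

open WeierstrassCurve Literature.NumberTheory.EllipticCurves Literature.NumberTheory.GaloisRepresentations
  Summit.BirchSwinnertonDyer.Rank1Residual.Additive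
  Summit.BirchSwinnertonDyer.Rank1Residual.Additive.StrictSha

namespace Summit.BirchSwinnertonDyer.Rank1Residual.X12.O11

/-! ### §4 Over `ℚ`: `#Sel_str(E/ℚ)[p^∞] = p^ñ · #Ш(E/ℚ)[p^∞]`, local `p`-torsion allowed -/

/-- **`#Sel_str(E/ℚ)[p^∞] = p^ñ · #Ш(E/ℚ)[p^∞]` for EVERY elliptic `E/ℚ` of rank one and every prime
`p`, `ñ` = the `p`-divisibility level of the generator in `E(ℚ_p)` MODULO TORSION** — no hypothesis
on `E(ℚ_p)[p]` (b2b's `strictSelmerIndexAt_holds` is the case `E(ℚ_p)[p] = 0`, `ñ = n`). §3 fed with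
`λ : E(ℚ_p) → ℤ_p` from AEC VII.6.3 (`exists_addMonoidHom_padicInt_ker_torsion_pow_mem_range`) and the
transport of the Selmer local condition to `ℚ_[p]` (`selmerGroupPInfty_le_selmerLocalKerPrimary_padic`).
[cite: GreenbergLNM1716, §2 (pp. 62–63)] [cite: KuriharaPollack2007, §1.5 (p. 361)]
[cite: SilvermanAEC2009, Prop. VII.6.3] -/
theorem card_strictSelmerPInfty_eq_pow_mul_card_sha_modTorsion (W : WeierstrassCurve ℚ)
    [W.IsElliptic] (p : ℕ) [Fact p.Prime] {P : W.toAffine.Point} {n : ℕ} (hP : ¬ IsOfFinAddOrder P)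
    (hgen : ∀ R : W.toAffine.Point, ∃ (k : ℤ) (T : W.toAffine.Point),
      IsOfFinAddOrder T ∧ R = k • P + T)
    (hdiv : ∃ Q T : (W.baseChange ℚ_[p]).toAffine.Point, IsOfFinAddOrder T ∧
      p ^ n • Q = W.toPadicPoint p P + T)
    (hndiv : ∀ Q T : (W.baseChange ℚ_[p]).toAffine.Point, IsOfFinAddOrder T →
      p ^ (n + 1) • Q ≠ W.toPadicPoint p P + T) :
    Nat.card ↥(strictSelmerPInfty W p) = p ^ n * Nat.card (AddCommGroup.primaryComponent W.sha p) := by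
  obtain ⟨lam, b, hlam, hlamb⟩ :=
    exists_addMonoidHom_padicInt_ker_torsion_pow_mem_range p (W.baseChange ℚ_[p])
  -- (the general form is elaborated with the classical `DecidableEq K`; over `ℚ` the instance
  -- `instDecidableEqRat` is found instead — `convert` bridges the subsingleton instance gap)
  refine card_strictSelmer_eq_pow_mul_card_sha_modTorsion W p ℚ_[p] lam hlam hlamb
    (selmerGroupPInfty_le_selmerLocalKerPrimary_padic W p) (P := P) ?_ ?_ hdiv hndiv
  · convert hP
  · intro R
    obtain ⟨k, T, hT, hR⟩ := hgen R
    exact ⟨k, T, by convert hT, by convert hR⟩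

/-- With `Ш(E/ℚ)[p^∞]` finite: **`ord_p #Sel_str(E/ℚ)[p^∞] = ñ + ord_p #Ш(E/ℚ)[p^∞]`**, local
`p`-torsion allowed (the form the regime-T consumer uses). [cite: GreenbergLNM1716, §2 (pp. 62–63)] -/
theorem padicValNat_card_strictSelmerPInfty_eq_modTorsion (W : WeierstrassCurve ℚ) [W.IsElliptic]
    (p : ℕ) [Fact p.Prime] {P : W.toAffine.Point} {n : ℕ} (hP : ¬ IsOfFinAddOrder P)
    (hgen : ∀ R : W.toAffine.Point, ∃ (k : ℤ) (T : W.toAffine.Point),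
      IsOfFinAddOrder T ∧ R = k • P + T)
    (hdiv : ∃ Q T : (W.baseChange ℚ_[p]).toAffine.Point, IsOfFinAddOrder T ∧
      p ^ n • Q = W.toPadicPoint p P + T)
    (hndiv : ∀ Q T : (W.baseChange ℚ_[p]).toAffine.Point, IsOfFinAddOrder T →
      p ^ (n + 1) • Q ≠ W.toPadicPoint p P + T)
    [Finite (AddCommGroup.primaryComponent W.sha p)] :
    padicValNat p (Nat.card ↥(strictSelmerPInfty W p)) =
      n + padicValNat p (Nat.card (AddCommGroup.primaryComponent W.sha p)) := by
  have hne : Nat.card (AddCommGroup.primaryComponent W.sha p) ≠ 0 := Nat.card_pos.ne'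
  have hpn : p ^ n ≠ 0 := pow_ne_zero n (Fact.out : p.Prime).ne_zero
  rw [card_strictSelmerPInfty_eq_pow_mul_card_sha_modTorsion W p hP hgen hdiv hndiv,
    padicValNat.mul hpn hne, padicValNat.prime_pow]

/-- **Mordell–Weil data with its MOD-TORSION level**, for any curve of rank one and any prime (no
local torsion hypothesis): a generator `P` of `E(ℚ)` modulo torsion and its exact `p`-divisibility
level modulo torsion in `E(ℚ_p)` (`exists_modTorsion_level` with AEC VII.6.3's `λ`). The regime-T
twin of `RamifiedSevenEllipticUnits.exists_generator_with_level`.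
[cite: SilvermanAEC2009, Prop. VII.6.3 and Thm. VIII.6.7] -/
theorem exists_generator_with_modTorsion_level (W : WeierstrassCurve ℚ) [W.IsElliptic] (p : ℕ)
    [Fact p.Prime] (hrank : W.mordellWeilRank = 1) :
    ∃ (P : W.toAffine.Point) (n : ℕ), ¬ IsOfFinAddOrder P ∧
      (∀ R : W.toAffine.Point, ∃ (k : ℤ) (T : W.toAffine.Point), IsOfFinAddOrder T ∧ R = k • P + T) ∧
      (∃ Q T : (W.baseChange ℚ_[p]).toAffine.Point, IsOfFinAddOrder T ∧
        p ^ n • Q = W.toPadicPoint p P + T) ∧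
      (∀ Q T : (W.baseChange ℚ_[p]).toAffine.Point, IsOfFinAddOrder T →
        p ^ (n + 1) • Q ≠ W.toPadicPoint p P + T) := by
  obtain ⟨P, hP, hgen⟩ := exists_generator_of_mordellWeilRank_eq_one W hrank
  obtain ⟨lam, hlam⟩ := exists_addMonoidHom_padicInt_apply_eq_zero_iff p (W.baseChange ℚ_[p])
  have hinj : Function.Injective (W.toPadicPoint p) :=
    Affine.Point.map_injective (W' := W) (Algebra.ofId ℚ ℚ_[p])
  have hP' : ¬ IsOfFinAddOrder P := by convert hP
  have hPp : ¬ IsOfFinAddOrder (W.toPadicPoint p P) := by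
    intro h
    apply hP'
    obtain ⟨m, hm, hmP⟩ := isOfFinAddOrder_iff_nsmul_eq_zero.mp h
    refine isOfFinAddOrder_iff_nsmul_eq_zero.mpr ⟨m, hm, hinj ?_⟩
    rw [map_nsmul, map_zero]
    exact hmP
  obtain ⟨n, hdiv, hndiv⟩ := exists_modTorsion_level p lam hlam hPp
  refine ⟨P, n, hP', fun R => ?_, hdiv, hndiv⟩
  obtain ⟨a, t, ht, hR⟩ := hgen R
  exact ⟨a, t, by convert ht, by convert hR⟩

end Summit.BirchSwinnertonDyer.Rank1Residual.X12.O11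

end
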